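import Mathlib
import HarnessLib
import Summits.Ventures.LatticeQCDFlow.Exactness.SphereTiltedSpectralGap
import Summits.Ventures.LatticeQCDFlow.Exactness.SphereKickJacobianTransport

/-!
# The spectral gap `d − 1` of `𝓛₀ = −Σ∂̃²` for ALL `C²` functionals on the lattice of site spheres of a GENERAL finite-dimensional inner product space, by isometric transport from `ℝ^{m+2}` — and the Holley–Stroock gap of `𝓛_t` for all `C²` functionals on general `E`

HONEST FRAMING: exact (Metropolis-corrected) sampling algorithms for lattice gauge theory;
figures of merit are autocorrelation/cost numbers at stated couplings and volumes; no
continuum-physics claim.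

Venture `LatticeQCDFlow` (cell pub-lqcd), topic `Exactness`; FANOUT row 7 (`s0-cpn-null`).  NEW WORK
of the cell over the tree's `Exactness/SphereLatticePoincare.lean` (GEN-8: `(m+1)·Var_π̄(F) ≤ Σ_k∫‖∂̃_kF‖²dπ̄`
for every `C²` functional `F`, but ONLY for `E = ℝ^{m+2}`), `Exactness/SphereKickJacobianTransport.lean`
(GEN-5: `isoSphere T`, `map_isoSphere_toSphere` — a linear isometry maps the sphere measure to the sphere
measure), `Exactness/SphereTiltedSpectralGap.lean` (this leg: `holleyStroock_transfer`, the energy identity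
route to the gap of `𝓛_t`) and Mathlib (`stdOrthonormalBasis`, `LinearIsometryEquiv.measurePreserving`,
`ContinuousLinearEquiv.comp_right_fderiv`, `measurePreserving_pi`); nothing is cited as a fact.  Printed
counterpart, NAMED ONLY: M. Lüscher, Commun. Math. Phys. 293 (2010) 899, §3.3 / §4.2 (the Laplacian on
the field manifold has a gap above its constant zero modes).  HANDOFF GEN-8 (c) / GEN-10 (c) asked for
"the gap for general `E` (transport `lattice_sphere_spectral_gap` through a linear isometry
`E ≃ ℝ^d`)"; GEN-10/11 have it for lattice POLYNOMIALS on general `E` by the spectral resolution.  THIS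
FILE does the transport, so the gap `d − 1` holds for every `C²` functional on `Ω = S(E)^Λ` for every
finite-dimensional real inner product space `E` with `d = dim E ≥ 2`, and consequently the finite-`t`
Holley–Stroock gap of this leg holds for all `C²` functionals on general `E` as well.

## Content

* §1 TRANSPORT ALONG A LINEAR ISOMETRY `T : E ≃ₗᵢ E′`: `map_normalize_linearIsometryEquiv`,
  `symm_update_comp`, **`siteGrad_comp_linearIsometryEquiv`** (`∂̃_k(F∘T⁻¹)(Tx) = T(∂̃_kF(x))`),
  `norm_siteGrad_comp_linearIsometryEquiv`, **`measurePreserving_isoSphere_uniformSphere`** (`σ̄_E ↦ σ̄_{E′}`),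
  **`measurePreserving_pi_isoSphere`** (`π̄_E ↦ π̄_{E′}`).
* §2 **`lattice_sphere_poincare_general`** — `(d−1)·(∫F²dπ̄ − (∫F dπ̄)²) ≤ Σ_k∫‖∂̃_kF‖²dπ̄` for every `C²`
  functional `F` on `(Λ → E)`, general `E`, `d = dim E ≥ 2`, every finite `Λ`;
  **`lattice_sphere_spectral_gap_general`** (the same with `∫F·(−Σ∂̃²F)dπ̄` on the right).
* §3 **`tilted_spectral_gap_general`** — `a ≤ −tS ≤ b` on `Ω` ⇒
  `(d−1)·∫e^{−tS}(F − ⟨F⟩_t)²dπ̄ ≤ e^{b−a}·∫e^{−tS}F·𝓛_tF dπ̄` for every `C²` `F`, general `E`.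

NOT CLAIMED: sharper (volume-independent) constants at `t ≠ 0`; existence of the finite-`t` flow action;
anything about the rung.
-/

noncomputable section

namespace Summit.Ventures.LatticeQCDFlow.Exactness

open Function Set Metric MeasureTheory NormedSpace InnerProductSpace
open scoped RealInnerProductSpace

variable {Λ : Type*} [Fintype Λ] [DecidableEq Λ]
variable {E : Type*} [NormedAddCommGroup E] [InnerProductSpace ℝ E] [FiniteDimensional ℝ E]
  [MeasurableSpace E] [BorelSpace E]
variable {E' : Type*} [NormedAddCommGroup E'] [InnerProductSpace ℝ E'] [FiniteDimensional ℝ E']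
  [MeasurableSpace E'] [BorelSpace E']

/-! ## §1 Transport along a linear isometry -/

section Transport

variable (T : E ≃ₗᵢ[ℝ] E')

omit [Fintype Λ] [DecidableEq Λ] [FiniteDimensional ℝ E] [MeasurableSpace E] [BorelSpace E]
  [FiniteDimensional ℝ E'] [MeasurableSpace E'] [BorelSpace E'] in
/-- A linear isometry commutes with normalisation: `T(y/‖y‖) = (Ty)/‖Ty‖`. -/
theorem map_normalize_linearIsometryEquiv (y : E) : T (normalize y) = normalize (T y) := by
  simp only [NormedSpace.normalize, map_smul, LinearIsometryEquiv.norm_map]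

omit [Fintype Λ] [FiniteDimensional ℝ E] [MeasurableSpace E] [BorelSpace E] [FiniteDimensional ℝ E']
  [MeasurableSpace E'] [BorelSpace E'] in
/-- Pulling a configuration back through `T⁻¹` commutes with updating a site. -/
theorem symm_update_comp (x : Λ → E) (k : Λ) (v : E') :
    (fun n => T.symm (update (fun n => T (x n)) k v n)) = update x k (T.symm v) := by
  funext n
  by_cases hn : n = k
  · subst hn; simp
  · simp [update_of_ne hn]

omit [Fintype Λ] [MeasurableSpace E] [BorelSpace E] [MeasurableSpace E'] [BorelSpace E'] in
/-- **The natural site gradient is covariant under linear isometries**: for `F : (Λ → E) → ℝ` and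
`F′(y) = F(T⁻¹∘y)`, `∂̃_k F′(T∘x) = T(∂̃_k F(x))`. -/
theorem siteGrad_comp_linearIsometryEquiv (F : (Λ → E) → ℝ) (x : Λ → E) (k : Λ) :
    siteGrad k (fun y : Λ → E' => F (fun n => T.symm (y n))) (fun n => T (x n)) =
      T (siteGrad k F x) := by
  unfold siteGrad gradient
  set φ : E → ℝ := fun y => F (update x k (normalize y)) with hφ
  have hfun : (fun y' : E' => F (fun n => T.symm (update (fun n => T (x n)) k (normalize y') n))) =
      φ ∘ ⇑(T.symm.toContinuousLinearEquiv) := by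
    funext y'
    simp only [comp_apply, LinearIsometryEquiv.coe_toContinuousLinearEquiv, hφ]
    rw [symm_update_comp T x k, map_normalize_linearIsometryEquiv T.symm y']
  rw [hfun, ContinuousLinearEquiv.comp_right_fderiv]
  simp only [LinearIsometryEquiv.coe_toContinuousLinearEquiv, LinearIsometryEquiv.symm_apply_apply]
  refine ext_inner_right ℝ fun w => ?_
  rw [toDual_symm_apply, LinearIsometryEquiv.inner_map_eq_flip, toDual_symm_apply]
  rfl

omit [Fintype Λ] [MeasurableSpace E] [BorelSpace E] [MeasurableSpace E'] [BorelSpace E'] in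
/-- … so its norm is invariant: `‖∂̃_k F′(T∘x)‖ = ‖∂̃_k F(x)‖`. -/
theorem norm_siteGrad_comp_linearIsometryEquiv (F : (Λ → E) → ℝ) (x : Λ → E) (k : Λ) :
    ‖siteGrad k (fun y : Λ → E' => F (fun n => T.symm (y n))) (fun n => T (x n))‖ =
      ‖siteGrad k F x‖ := by
  rw [siteGrad_comp_linearIsometryEquiv, LinearIsometryEquiv.norm_map]

variable [Nontrivial E] [Nontrivial E']

omit [Fintype Λ] [DecidableEq Λ] [Nontrivial E] [Nontrivial E'] in
/-- **A linear isometry maps the normalised sphere measure to the normalised sphere measure.** -/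
theorem measurePreserving_isoSphere_uniformSphere :
    MeasurePreserving (isoSphere T) (uniformSphere (volume : Measure E))
      (uniformSphere (volume : Measure E')) := by
  refine ⟨(isoSphere T).measurable, ?_⟩
  have hmap : ((volume : Measure E).toSphere).map (isoSphere T) = (volume : Measure E').toSphere := by
    rw [map_isoSphere_toSphere, T.measurePreserving.map_eq]
  have huniv : (volume : Measure E).toSphere univ = (volume : Measure E').toSphere univ := by
    rw [← hmap, MeasurableEquiv.map_apply, preimage_univ]
  rw [uniformSphere, uniformSphere, Measure.map_smul, hmap, huniv]

omit [DecidableEq Λ] [Nontrivial E] in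
/-- **The sitewise isometry preserves `π̄`**: `(ω ↦ (n ↦ T ω_n))_* π̄_E = π̄_{E′}`. -/
theorem measurePreserving_pi_isoSphere :
    MeasurePreserving (MeasurableEquiv.piCongrRight fun _ : Λ => isoSphere T)
      (Measure.pi (fun _ : Λ => uniformSphere (volume : Measure E)))
      (Measure.pi (fun _ : Λ => uniformSphere (volume : Measure E'))) :=
  measurePreserving_pi (fun _ : Λ => uniformSphere (volume : Measure E))
    (fun _ : Λ => uniformSphere (volume : Measure E')) fun _ => measurePreserving_isoSphere_uniformSphere T

omit [DecidableEq Λ] [Nontrivial E] in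
/-- Integrals over `π̄_{E′}` are integrals over `π̄_E` of the transported integrand. -/
theorem integral_pi_isoSphere_comp (G : (Λ → sphere (0 : E') 1) → ℝ) :
    ∫ ω, G (fun n => isoSphere T (ω n)) ∂Measure.pi (fun _ : Λ => uniformSphere (volume : Measure E)) =
      ∫ ω', G ω' ∂Measure.pi (fun _ : Λ => uniformSphere (volume : Measure E')) :=
  (measurePreserving_pi_isoSphere (Λ := Λ) T).integral_comp' G

end Transport

/-! ## §2 The gap `d − 1` for all `C²` functionals, general `E` -/

section Gap

variable [Nontrivial E]

omit [Nontrivial E] in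
/-- **THE SPECTRAL GAP OF `𝓛₀` FOR ALL `C²` FUNCTIONALS ON A GENERAL FINITE-DIMENSIONAL `E`**
(`d = dim E ≥ 2`, every finite `Λ`): `(d−1)·(∫F²dπ̄ − (∫F dπ̄)²) ≤ Σ_k∫‖∂̃_kF‖²dπ̄` — GEN-8's
`lattice_sphere_poincare` transported along an orthonormal-basis isometry `E ≃ ℝ^{d}`. -/
theorem lattice_sphere_poincare_general (h2 : 2 ≤ Module.finrank ℝ E) {F : (Λ → E) → ℝ}
    (hF : ContDiff ℝ 2 F) :
    ((Module.finrank ℝ E : ℝ) - 1) *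
        ((∫ ω, F (fun n => ((ω : Λ → sphere (0 : E) 1) n : E)) ^ 2
            ∂Measure.pi (fun _ : Λ => uniformSphere (volume : Measure E))) -
          (∫ ω, F (fun n => ((ω : Λ → sphere (0 : E) 1) n : E))
            ∂Measure.pi (fun _ : Λ => uniformSphere (volume : Measure E))) ^ 2) ≤
      ∑ k, ∫ ω, ‖siteGrad k F (fun n => ((ω : Λ → sphere (0 : E) 1) n : E))‖ ^ 2
        ∂Measure.pi (fun _ : Λ => uniformSphere (volume : Measure E)) := by
  obtain ⟨m, hm⟩ : ∃ m : ℕ, Module.finrank ℝ E = m + 2 := ⟨Module.finrank ℝ E - 2, by omega⟩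
  -- the isometry `E ≃ ℝ^{m+2}` and the transported functional
  set T : E ≃ₗᵢ[ℝ] EuclideanSpace ℝ (Fin (m + 2)) :=
    ((stdOrthonormalBasis ℝ E).reindex (finCongr hm)).repr with hT
  set F' : (Λ → EuclideanSpace ℝ (Fin (m + 2))) → ℝ := fun y => F (fun n => T.symm (y n)) with hF'
  have hF'c : ContDiff ℝ 2 F' := by
    refine hF.comp (contDiff_pi.2 fun n => ?_)
    exact T.symm.toContinuousLinearEquiv.contDiff.comp
      (contDiff_apply ℝ (EuclideanSpace ℝ (Fin (m + 2))) n)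
  have hP := lattice_sphere_poincare (Λ := Λ) hF'c
  -- transport every integral back to `E`
  have hcoe : ∀ ω : Λ → sphere (0 : E) 1,
      (fun n => ((isoSphere T (ω n) : sphere (0 : EuclideanSpace ℝ (Fin (m + 2))) 1) :
        EuclideanSpace ℝ (Fin (m + 2)))) = fun n => T (ω n : E) := fun ω => by
    funext n; simp [coe_isoSphere]
  have hval : ∀ ω : Λ → sphere (0 : E) 1, F' (fun n => T (ω n : E)) = F (fun n => (ω n : E)) :=
    fun ω => by simp [hF']
  have h1 : ∫ ω', F' (fun n => (ω' n : EuclideanSpace ℝ (Fin (m + 2)))) ^ 2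
      ∂Measure.pi (fun _ : Λ => uniformSphere (volume : Measure (EuclideanSpace ℝ (Fin (m + 2))))) =
      ∫ ω, F (fun n => ((ω : Λ → sphere (0 : E) 1) n : E)) ^ 2
        ∂Measure.pi (fun _ : Λ => uniformSphere (volume : Measure E)) := by
    rw [← integral_pi_isoSphere_comp T]
    simp_rw [hcoe, hval]
  have h2' : ∫ ω', F' (fun n => (ω' n : EuclideanSpace ℝ (Fin (m + 2))))
      ∂Measure.pi (fun _ : Λ => uniformSphere (volume : Measure (EuclideanSpace ℝ (Fin (m + 2))))) =
      ∫ ω, F (fun n => ((ω : Λ → sphere (0 : E) 1) n : E))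
        ∂Measure.pi (fun _ : Λ => uniformSphere (volume : Measure E)) := by
    rw [← integral_pi_isoSphere_comp T]
    simp_rw [hcoe, hval]
  have h3 : ∀ k, ∫ ω', ‖siteGrad k F' (fun n => (ω' n : EuclideanSpace ℝ (Fin (m + 2))))‖ ^ 2
      ∂Measure.pi (fun _ : Λ => uniformSphere (volume : Measure (EuclideanSpace ℝ (Fin (m + 2))))) =
      ∫ ω, ‖siteGrad k F (fun n => ((ω : Λ → sphere (0 : E) 1) n : E))‖ ^ 2
        ∂Measure.pi (fun _ : Λ => uniformSphere (volume : Measure E)) := fun k => by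
    rw [← integral_pi_isoSphere_comp T]
    simp_rw [hcoe]
    refine integral_congr_ae (ae_of_all _ fun ω => ?_)
    simp only [hF']
    rw [norm_siteGrad_comp_linearIsometryEquiv T F (fun n => (ω n : E)) k]
  rw [h1, h2'] at hP
  simp_rw [h3] at hP
  have hd : ((Module.finrank ℝ E : ℝ) - 1) = (m : ℝ) + 1 := by
    rw [hm]; push_cast; ring
  rw [hd]
  exact hP

/-- **The gap in operator form**, general `E`: `(d−1)·Var_π̄(F) ≤ ∫F·(−Σ_k∂̃_k·∂̃_kF)dπ̄` for `F ∈ C²`. -/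
theorem lattice_sphere_spectral_gap_general (h2 : 2 ≤ Module.finrank ℝ E) {F : (Λ → E) → ℝ}
    (hF : ContDiff ℝ 2 F) :
    ((Module.finrank ℝ E : ℝ) - 1) *
        ((∫ ω, F (fun n => ((ω : Λ → sphere (0 : E) 1) n : E)) ^ 2
            ∂Measure.pi (fun _ : Λ => uniformSphere (volume : Measure E))) -
          (∫ ω, F (fun n => ((ω : Λ → sphere (0 : E) 1) n : E))
            ∂Measure.pi (fun _ : Λ => uniformSphere (volume : Measure E))) ^ 2) ≤
      ∫ ω, F (fun n => ((ω : Λ → sphere (0 : E) 1) n : E)) *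
          -∑ k, siteLaplacian k F (fun n => (ω n : E))
        ∂Measure.pi (fun _ : Λ => uniformSphere (volume : Measure E)) := by
  rw [integral_mul_luscher_uniform hF]
  exact lattice_sphere_poincare_general h2 hF

end Gap

/-! ## §3 The Holley–Stroock gap of `𝓛_t` for all `C²` functionals, general `E` -/

section Tilted

variable [Nontrivial E] {S : (Λ → E) → ℝ} {t a b : ℝ}

/-- **SPECTRAL GAP OF `𝓛_t` ON ALL `C²` FUNCTIONALS, GENERAL `E`** (`d = dim E ≥ 2`, every finite `Λ`,
every real `t`): if `a ≤ −tS ≤ b` on `Ω` (`S ∈ C¹`) then for every `C²` functional `F`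
`(d−1)·∫e^{−tS}(F − ⟨F⟩_t)²dπ̄ ≤ e^{b−a}·∫e^{−tS}F·𝓛_tF dπ̄`. -/
theorem tilted_spectral_gap_general (h2 : 2 ≤ Module.finrank ℝ E) (hS : ContDiff ℝ 1 S)
    (hlo : ∀ ω : Λ → sphere (0 : E) 1, a ≤ -(t * S (fun m => (ω m : E))))
    (hhi : ∀ ω : Λ → sphere (0 : E) 1, -(t * S (fun m => (ω m : E))) ≤ b)
    {F : (Λ → E) → ℝ} (hF : ContDiff ℝ 2 F) :
    ((Module.finrank ℝ E : ℝ) - 1) *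
        ∫ ω, Real.exp (-(t * S (fun m => ((ω : Λ → sphere (0 : E) 1) m : E)))) *
          (F (fun m => (ω m : E)) -
            (∫ ω', Real.exp (-(t * S (fun m => ((ω' : Λ → sphere (0 : E) 1) m : E)))) *
                F (fun m => (ω' m : E)) ∂Measure.pi (fun _ : Λ => uniformSphere (volume : Measure E))) /
              ∫ ω', Real.exp (-(t * S (fun m => ((ω' : Λ → sphere (0 : E) 1) m : E))))
                ∂Measure.pi (fun _ : Λ => uniformSphere (volume : Measure E))) ^ 2
          ∂Measure.pi (fun _ : Λ => uniformSphere (volume : Measure E)) ≤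
      Real.exp (b - a) * ∫ ω, Real.exp (-(t * S (fun m => ((ω : Λ → sphere (0 : E) 1) m : E)))) *
          F (fun m => (ω m : E)) * sphereLuscherL S t F (fun m => (ω m : E))
        ∂Measure.pi (fun _ : Λ => uniformSphere (volume : Measure E)) := by
  rw [integral_exp_mul_self_sphereLuscherL hS hF t]
  have hP := lattice_sphere_poincare_general (Λ := Λ) h2 hF
  have hd : 0 ≤ (Module.finrank ℝ E : ℝ) - 1 := by
    have : (2 : ℝ) ≤ Module.finrank ℝ E := by exact_mod_cast h2
    linarith
  have hFc : Continuous fun ω : Λ → sphere (0 : E) 1 => F (fun n => (ω n : E)) :=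
    hF.continuous.comp continuous_sphereConfig
  set c₀ : ℝ := ∫ ω, F (fun n => ((ω : Λ → sphere (0 : E) 1) n : E))
    ∂Measure.pi (fun _ : Λ => uniformSphere (volume : Measure E)) with hc₀
  have hvar : ∫ ω, (F (fun n => ((ω : Λ → sphere (0 : E) 1) n : E)) - c₀) ^ 2
        ∂Measure.pi (fun _ : Λ => uniformSphere (volume : Measure E)) =
      (∫ ω, F (fun n => ((ω : Λ → sphere (0 : E) 1) n : E)) ^ 2
          ∂Measure.pi (fun _ : Λ => uniformSphere (volume : Measure E))) - c₀ ^ 2 := by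
    set μ := Measure.pi (fun _ : Λ => uniformSphere (volume : Measure E)) with hμ
    have hi1 : Integrable (fun ω : Λ → sphere (0 : E) 1 => F (fun n => (ω n : E)) ^ 2) μ :=
      integrable_pi_of_continuous _ (hFc.pow 2)
    have hi2 : Integrable (fun ω : Λ → sphere (0 : E) 1 => 2 * c₀ * F (fun n => (ω n : E))) μ :=
      (integrable_pi_of_continuous _ hFc).const_mul _
    have hi12 : Integrable (fun ω : Λ → sphere (0 : E) 1 =>
        F (fun n => (ω n : E)) ^ 2 - 2 * c₀ * F (fun n => (ω n : E))) μ := hi1.sub hi2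
    have hfun : (fun ω : Λ → sphere (0 : E) 1 => (F (fun n => (ω n : E)) - c₀) ^ 2) =
        fun ω => F (fun n => (ω n : E)) ^ 2 - 2 * c₀ * F (fun n => (ω n : E)) + c₀ ^ 2 := by
      funext ω; ring
    rw [hfun, integral_add hi12 (integrable_const _), integral_sub hi1 hi2, integral_const_mul,
      ← hc₀, integral_const, smul_eq_mul, Measure.real, measure_univ, ENNReal.toReal_one, one_mul]
    ring
  have hgk : ∀ k, Continuous fun ω : Λ → sphere (0 : E) 1 => ‖siteGrad k F (fun n => (ω n : E))‖ ^ 2 :=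
    fun k => ((continuous_siteGrad_sphereConfig (hF.of_le (by norm_num)) k).norm).pow 2
  have hwgk : ∀ k, Continuous fun ω : Λ → sphere (0 : E) 1 =>
      Real.exp (-(t * S (fun n => (ω n : E)))) * ‖siteGrad k F (fun n => (ω n : E))‖ ^ 2 := fun k =>
    (continuous_exp_neg_mul_sphereConfig hS.continuous t).mul (hgk k)
  have hgap : ((Module.finrank ℝ E : ℝ) - 1) *
      ∫ ω, (F (fun n => ((ω : Λ → sphere (0 : E) 1) n : E)) - c₀) ^ 2
        ∂Measure.pi (fun _ : Λ => uniformSphere (volume : Measure E)) ≤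
      ∫ ω, ∑ k, ‖siteGrad k F (fun n => ((ω : Λ → sphere (0 : E) 1) n : E))‖ ^ 2
        ∂Measure.pi (fun _ : Λ => uniformSphere (volume : Measure E)) := by
    rw [hvar, integral_finsetSum _ fun k _ => integrable_pi_of_continuous _ (hgk k)]
    exact hP
  have hD : Continuous fun ω : Λ → sphere (0 : E) 1 => ∑ k, ‖siteGrad k F (fun n => (ω n : E))‖ ^ 2 :=
    continuous_finsetSum _ fun k _ => hgk k
  have hmain := holleyStroock_transfer (t := t) hS.continuous hlo hhi hFc hD
    (fun ω => Finset.sum_nonneg fun k _ => sq_nonneg _) hd hgap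
  refine hmain.trans (le_of_eq ?_)
  congr 1
  rw [← integral_finsetSum _ fun k _ => integrable_pi_of_continuous _ (hwgk k)]
  refine integral_congr_ae (ae_of_all _ fun ω => ?_)
  simp only [Finset.mul_sum]

end Tilted

end Summit.Ventures.LatticeQCDFlow.Exactness

end
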